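import Summits.HubbardSuperconductivity.HubbardSuperconductivity.Theorems.WidthHaldaneTubeCanonical

/-!
# The target `TubeFamilyLaw` (S⁺) of route `WidthHaldane`: faithfulness, canonical carrier,
# derivation from the cruxes, and the summit from the target

Support file for the TARGET item stmt-HubbardSuperconductivity-16310 `TubeFamilyLaw` (the
strengthened summit S⁺: a width-uniform column `d_{x²-y²}` pair power law on every even Hubbard tube
`ℤ/L × ℤ/M`, `M₁ ≤ M ≤ L`). The route file `Theses/WidthHaldane.lean` proves `closes` (cruxes ⇒
summit) with the target inlined as a `have`; this file NAMES the kernel-checked logical levers of the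
target that the shared vocabulary file `WidthHaldaneDefs` does not carry:

* `tubeFamilyLaw_iff` — the item over the names of `WidthHaldaneDefs` (`tubeH0`, `tubeFilling`,
  `tubeColumnPairCorr`), by `Iff.rfl`;
* `tubeFamilyLaw_iff_canonical` — the "`∀` linearly ordered labellings `e : Λ ≃ ℤ/L × ℤ/M`" clause is
  free: the law holds iff it holds on the canonical carriers `Fin (L·M)` (signed-permutation
  transport of norms, sector ground states and the column pair correlation,
  `WidthHaldaneTubeCanonical`);
* `columnLaw_mono`, `tubeFamilyLaw_iff_one_le` — the matrix of the law is monotone in its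
  constants (larger `C, R, M₁, L₀`, smaller `A`), so witnesses may be normalised to `R ≥ 1`;
* `tubeFamilyLaw_of_widthHaldaneBridge` — cruxes ⇒ target
  (`WidthHaldaneBridge → WidthUniformThermodynamics → TubeFamilyLaw`, part (1) of `closes` as a
  standalone theorem, exponent `C := Ξ √(k₀/d₀)` by `rpow` monotonicity);
* `torusColumnLaw_of_tubeFamilyLaw` — the diagonal slice `M = L` read on the summit's carrier
  `FermionTorus 2 L` in the summit's vocabulary (`hubbardTorus 2 L 1 U`,
  `localPair dWaveFormFactor`): a column law `A L³ r̂^{-C/L} ≤ Σ_{a,b,b'} Re⟨ψ, P†_{(a,b)} P_{(a+r,b')} ψ⟩`;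
* `hubbardSuperconductivity_of_tubeFamilyLaw` — **target ⇒ summit** without the cruxes
  (parts (2)–(3) of `closes` as a standalone theorem), so that ANY proof of S⁺ closes the summit.

Everything is PROVED (no `sorry`, no new definition, no named fact); the two long proofs are the
corresponding steps of the planner's `closes`, re-cut at the target.

References (for the objects, not for any claim): D. J. Scalapino, Phys. Rep. 250 (1995) 329, §2
eq. (2.4) (the `d_{x²-y²}` pair field and its LRO); O. Bratteli, D. W. Robinson, *Operator Algebras
and Quantum Statistical Mechanics II* (1997) §5.2.2, Thm. 5.2.5 (relabelling unitaries).
-/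

noncomputable section

namespace Summit.HubbardSuperconductivity.HubbardSuperconductivity.Theorems.WidthHaldane

set_option linter.dupNamespace false -- summit = problem name (single-conjunct summit), D-0017

open scoped BigOperators Classical Matrix ComplexConjugate
open Matrix Literature.MathematicalPhysics.QuantumLattice
open Summit.HubbardSuperconductivity.HubbardSuperconductivity.Theses.WidthHaldane
  (TubeFamilyLaw WidthHaldaneBridge WidthUniformThermodynamics)

/-! ### Faithfulness: the target over the names -/

/-- **`TubeFamilyLaw` (stmt-HubbardSuperconductivity-16310) over the names**: there are `U > 0`,
`δ ∈ (0, 1/2)`, `C ≥ 0`, `A > 0`, `R, M₁, L₀` such that every normalised `(N_{L,M}(δ), S^z = 0)`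
sector ground state `ψ` of every even tube (`M₁ ≤ M ≤ L`, `L ≥ L₀`, any labelling) obeys
`A·L·M²·r̂^{-C/M} ≤ G_ψ(r)` for `R ≤ r̂` — by `Iff.rfl` (the two sides are `δζ`-convertible).
[folklore] -/
theorem tubeFamilyLaw_iff :
    TubeFamilyLaw ↔
      ∃ U : ℝ, 0 < U ∧ ∃ δ ∈ Set.Ioo (0 : ℝ) (1 / 2), ∃ C : ℝ, 0 ≤ C ∧ ∃ A : ℝ, 0 < A ∧
        ∃ R M₁ L₀ : ℕ, ∀ (L M : ℕ) [NeZero L] [NeZero M], Even L → Even M → M₁ ≤ M → M ≤ L →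
          L₀ ≤ L → ∀ (Λ : Type) [LinearOrder Λ] [Fintype Λ] (e : Λ ≃ ZMod L × ZMod M),
            ∀ ψ : Fock (Orb Λ), star ψ ⬝ᵥ ψ = 1 →
              IsGroundStateInSector (tubeH0 L M Λ e U) (tubeFilling L M δ) 0 ψ →
                ∀ r : ZMod L, R ≤ r.val → r.val + R ≤ L →
                  A * (L : ℝ) * (M : ℝ) ^ 2 * ((min r.val (L - r.val) : ℕ) : ℝ) ^ (-(C / (M : ℝ))) ≤
                    tubeColumnPairCorr L M Λ e ψ r :=
  Iff.rfl

/-! ### Monotonicity of the matrix in the constants -/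

/-- **The column law is monotone in its constants.** If the matrix of `TubeFamilyLaw` holds at
`(U, δ)` with constants `(C, A, R, M₁, L₀)` then it holds with any `C' ≥ C`, `0 < A' ≤ A`,
`R' ≥ max(R, 1)`, `M₁' ≥ M₁`, `L₀' ≥ L₀` (for `r̂ ≥ R' ≥ 1` the factor `r̂^{-C/M}` decreases in `C`);
in particular witnesses may be normalised to `R ≥ 1` (`tubeFamilyLaw_iff_one_le`). [folklore] -/
theorem columnLaw_mono {U δ C C' A A' : ℝ} {R R' M₁ M₁' L₀ L₀' : ℕ} (hR' : 1 ≤ R') (hCC' : C ≤ C')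
    (hA' : 0 < A') (hAA' : A' ≤ A) (hRR' : R ≤ R') (hMM' : M₁ ≤ M₁') (hLL' : L₀ ≤ L₀')
    (h : ∀ (L M : ℕ) [NeZero L] [NeZero M], Even L → Even M → M₁ ≤ M → M ≤ L → L₀ ≤ L →
      ∀ (Λ : Type) [LinearOrder Λ] [Fintype Λ] (e : Λ ≃ ZMod L × ZMod M),
        ∀ ψ : Fock (Orb Λ), star ψ ⬝ᵥ ψ = 1 →
          IsGroundStateInSector (tubeH0 L M Λ e U) (tubeFilling L M δ) 0 ψ →
            ∀ r : ZMod L, R ≤ r.val → r.val + R ≤ L →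
              A * (L : ℝ) * (M : ℝ) ^ 2 * ((min r.val (L - r.val) : ℕ) : ℝ) ^ (-(C / (M : ℝ))) ≤
                tubeColumnPairCorr L M Λ e ψ r) :
    ∀ (L M : ℕ) [NeZero L] [NeZero M], Even L → Even M → M₁' ≤ M → M ≤ L → L₀' ≤ L →
      ∀ (Λ : Type) [LinearOrder Λ] [Fintype Λ] (e : Λ ≃ ZMod L × ZMod M),
        ∀ ψ : Fock (Orb Λ), star ψ ⬝ᵥ ψ = 1 →
          IsGroundStateInSector (tubeH0 L M Λ e U) (tubeFilling L M δ) 0 ψ →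
            ∀ r : ZMod L, R' ≤ r.val → r.val + R' ≤ L →
              A' * (L : ℝ) * (M : ℝ) ^ 2 * ((min r.val (L - r.val) : ℕ) : ℝ) ^ (-(C' / (M : ℝ))) ≤
                tubeColumnPairCorr L M Λ e ψ r := by
  intro L M _ _ hLe hMe hM hML hL Λ _ _ e ψ hψ hGS r hr hrL
  have hr' : R ≤ r.val := hRR'.trans hr
  have hrL' : r.val + R ≤ L := le_trans (Nat.add_le_add_left hRR' _) hrL
  have key := h L M hLe hMe (hMM'.trans hM) hML (hLL'.trans hL) Λ e ψ hψ hGS r hr' hrL'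
  refine le_trans ?_ key
  have hmin : (1 : ℝ) ≤ ((min r.val (L - r.val) : ℕ) : ℝ) := by
    have h1 : 1 ≤ r.val := hR'.trans hr
    have h2 : 1 ≤ L - r.val := by omega
    exact_mod_cast le_min h1 h2
  have hMpos : (0 : ℝ) < (M : ℝ) := by exact_mod_cast Nat.pos_of_ne_zero (NeZero.ne M)
  have hpow : ((min r.val (L - r.val) : ℕ) : ℝ) ^ (-(C' / (M : ℝ))) ≤
      ((min r.val (L - r.val) : ℕ) : ℝ) ^ (-(C / (M : ℝ))) := by
    apply Real.rpow_le_rpow_of_exponent_le hmin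
    rw [neg_le_neg_iff]
    exact div_le_div_of_nonneg_right hCC' hMpos.le
  have hpow0 : 0 ≤ ((min r.val (L - r.val) : ℕ) : ℝ) ^ (-(C' / (M : ℝ))) :=
    Real.rpow_nonneg (by positivity) _
  have hA0 : 0 ≤ A := hA'.le.trans hAA'
  calc A' * (L : ℝ) * (M : ℝ) ^ 2 * ((min r.val (L - r.val) : ℕ) : ℝ) ^ (-(C' / (M : ℝ)))
      ≤ A * (L : ℝ) * (M : ℝ) ^ 2 * ((min r.val (L - r.val) : ℕ) : ℝ) ^ (-(C' / (M : ℝ))) := by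
        gcongr
    _ ≤ A * (L : ℝ) * (M : ℝ) ^ 2 * ((min r.val (L - r.val) : ℕ) : ℝ) ^ (-(C / (M : ℝ))) := by
        gcongr

/-- **Normal form of the witnesses**: `TubeFamilyLaw` holds iff it holds with a threshold
`R ≥ 1` (so that only displacements with `r̂ ≥ 1` are ever tested and the base of `r̂^{-C/M}` is a
positive integer) — enlarge `R` to `max R 1` (`columnLaw_mono`). [folklore] -/
theorem tubeFamilyLaw_iff_one_le : Summit.HubbardSuperconductivity.HubbardSuperconductivity.Theses.WidthHaldane.TubeFamilyLaw ↔ ∃ U : ℝ, 0 < U ∧ ∃ δ ∈ Set.Ioo (0 : ℝ) (1 / 2), ∃ C : ℝ, 0 ≤ C ∧ ∃ A : ℝ, 0 < A ∧ ∃ R M₁ L₀ : ℕ, 1 ≤ R ∧ ∀ (L M : ℕ) [NeZero L] [NeZero M], Even L → Even M → M₁ ≤ M → M ≤ L → L₀ ≤ L → ∀ (Λ : Type) [LinearOrder Λ] [Fintype Λ] (e : Λ ≃ ZMod L × ZMod M), ∀ ψ : Fock (Orb Λ), star ψ ⬝ᵥ ψ = 1 → IsGroundStateInSector (tubeH0 L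 M Λ e U) (tubeFilling L M δ) 0 ψ → ∀ r : ZMod L, R ≤ r.val → r.val + R ≤ L → A * (L : ℝ) * (M : ℝ) ^ 2 * ((min r.val (L - r.val) : ℕ) : ℝ) ^ (-(C / (M : ℝ))) ≤ tubeColumnPairCorr L M Λ e ψ r := by
  rw [tubeFamilyLaw_iff]
  constructor
  · rintro ⟨U, hU, δ, hδ, C, hC, A, hA, R, M₁, L₀, h⟩
    exact ⟨U, hU, δ, hδ, C, hC, A, hA, max R 1, M₁, L₀, le_max_right R 1,
      columnLaw_mono (le_max_right R 1) le_rfl hA le_rfl (le_max_left R 1) le_rfl le_rfl h⟩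
  · rintro ⟨U, hU, δ, hδ, C, hC, A, hA, R, M₁, L₀, -, h⟩
    exact ⟨U, hU, δ, hδ, C, hC, A, hA, R, M₁, L₀, h⟩

/-! ### The `∀ labellings` clause is free -/

/-- **Canonical-carrier reduction of the target**: `TubeFamilyLaw` holds iff its matrix holds on
the canonical carriers `Fin (L·M)` labelled by `finProdFinEquiv` and `ZMod.finEquiv` — norms,
sector ground states of the pure tube and the column pair correlation are transported by the
signed-permutation relabelling between any two labellings of one tube (`star_relabelVec_self`,
`isGroundStateInSector_tubeH0_relabelVec`, `tubeColumnPairCorr_relabelVec`), so provers and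
refuters of S⁺ may fix the carrier. [cite: BratteliRobinsonII1997, §5.2.2, Thm. 5.2.5] -/
theorem tubeFamilyLaw_iff_canonical : Summit.HubbardSuperconductivity.HubbardSuperconductivity.Theses.WidthHaldane.TubeFamilyLaw ↔ ∃ U : ℝ, 0 < U ∧ ∃ δ ∈ Set.Ioo (0 : ℝ) (1 / 2), ∃ C : ℝ, 0 ≤ C ∧ ∃ A : ℝ, 0 < A ∧ ∃ R M₁ L₀ : ℕ, ∀ (L M : ℕ) [NeZero L] [NeZero M], Even L → Even M → M₁ ≤ M → M ≤ L → L₀ ≤ L → ∀ ψ : Fock (Orb (Fin (L * M))), star ψ ⬝ᵥ ψ = 1 → IsGroundStateInSector (tubeH0 L M (Fin (L * M)) (finProdFinEquiv.symm.trans (Equiv.prodCongr (ZMod.finEquiv L).toEquiv (ZMod.finEquiv M).toEquiv)) U) (tubeFilling L M δ) 0 ψ → ∀ r : ZMod L, R ≤ r.val → r.val + R ≤ L → A * (L : ℝ) * (M : ℝ) ^ 2 * ((min r.val (L - r.val) : ℕ) : ℝ) ^ (-(C / (M : ℝ))) ≤ tubeColumnPairCorr L M (Fin (L * M)) (finProdFinEquiv.symm.trans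 (Equiv.prodCongr (ZMod.finEquiv L).toEquiv (ZMod.finEquiv M).toEquiv)) ψ r := by
  rw [tubeFamilyLaw_iff]
  constructor
  · rintro ⟨U, hU, δ, hδ, C, hC, A, hA, R, M₁, L₀, h⟩
    exact ⟨U, hU, δ, hδ, C, hC, A, hA, R, M₁, L₀, fun L M _ _ hLe hMe hM hML hL ψ hψ hGS r hr hrL =>
      h L M hLe hMe hM hML hL (Fin (L * M)) _ ψ hψ hGS r hr hrL⟩
  · rintro ⟨U, hU, δ, hδ, C, hC, A, hA, R, M₁, L₀, h⟩
    refine ⟨U, hU, δ, hδ, C, hC, A, hA, R, M₁, L₀, ?_⟩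
    intro L M _ _ hLe hMe hM hML hL Λ _ _ e ψ hψ hGS r hr hrL
    set e₀ : Fin (L * M) ≃ ZMod L × ZMod M := finProdFinEquiv.symm.trans
      (Equiv.prodCongr (ZMod.finEquiv L).toEquiv (ZMod.finEquiv M).toEquiv) with he₀
    have key := h L M hLe hMe hM hML hL (relabelVec (Orb.mapEquiv (e.trans e₀.symm)) ψ)
      (by rw [star_relabelVec_self, hψ]) (isGroundStateInSector_tubeH0_relabelVec L M Λ e _ e₀ U hGS)
      r hr hrL
    rwa [tubeColumnPairCorr_relabelVec] at key

/-! ### Cruxes ⇒ target -/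

/-- **The two cruxes imply the target** (part (1) of the route's `closes`, as a standalone
theorem): at the `(U, δ, d₀, k₀, M₁, L₀)` of `WidthUniformThermodynamics` the Bridge gives the
Haldane-form law with exponent `Ξ√(ẽ″/ρ̃)/M ≤ Ξ√(k₀/d₀)/M`, and `r̂^{-x/M}` is antitone in `x` for
`r̂ ≥ 1`; so `TubeFamilyLaw` holds with `C := Ξ√(k₀/d₀)`, `R := max R 1`. [folklore] -/
theorem tubeFamilyLaw_of_widthHaldaneBridge : Summit.HubbardSuperconductivity.HubbardSuperconductivity.Theses.WidthHaldane.WidthHaldaneBridge → Summit.HubbardSuperconductivity.HubbardSuperconductivity.Theses.WidthHaldane.WidthUniformThermodynamics → Summit.HubbardSuperconductivity.HubbardSuperconductivity.Theses.WidthHaldane.TubeFamilyLaw := by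
  intro h1 h2
  rw [widthHaldaneBridge_iff] at h1
  rw [widthUniformThermodynamics_iff] at h2
  obtain ⟨U, hU, δ, hδ, d₀, hd₀, k₀, M₁, L₀, hth⟩ := h2
  obtain ⟨Ξ, hΞ, A, hA, R, M₂, L₁, hbr⟩ := h1 U hU δ hδ d₀ k₀ M₁ L₀ hd₀ hth
  rw [tubeFamilyLaw_iff]
  refine ⟨U, hU, δ, ⟨hδ.1, hδ.2.trans (by norm_num)⟩, Ξ * Real.sqrt (k₀ / d₀), by positivity,
    A, hA, max R 1, max M₁ M₂, max L₀ L₁, ?_⟩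
  intro L M _ _ hLe hMe hM hML hL Λ _ _ e ψ hψ hGS r hr hrL
  obtain ⟨hstiff, hic0, hick⟩ :=
    hth L M hLe hMe (le_of_max_le_left hM) hML (le_of_max_le_left hL) Λ e
  have key := hbr L M hLe hMe (le_of_max_le_right hM) hML (le_of_max_le_right hL) Λ e ψ hψ hGS
    r ((le_max_left R 1).trans hr) (le_trans (Nat.add_le_add_left (le_max_left R 1) _) hrL)
  refine le_trans ?_ key
  have hmin : (1 : ℝ) ≤ ((min r.val (L - r.val) : ℕ) : ℝ) := by
    have h1 : 1 ≤ r.val := (le_max_right R 1).trans hr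
    have h2 : 1 ≤ L - r.val := by
      have := le_trans (Nat.add_le_add_left (le_max_right R 1) _) hrL
      omega
    exact_mod_cast le_min h1 h2
  have hMpos : (0 : ℝ) < (M : ℝ) := by exact_mod_cast Nat.pos_of_ne_zero (NeZero.ne M)
  have hk₀ : 0 < k₀ := hic0.trans_le hick
  gcongr A * (L : ℝ) * (M : ℝ) ^ 2 * ?_
  apply Real.rpow_le_rpow_of_exponent_le hmin
  rw [neg_le_neg_iff]
  apply div_le_div_of_nonneg_right _ hMpos.le
  apply mul_le_mul_of_nonneg_left _ hΞ.le
  apply Real.sqrt_le_sqrt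
  rw [div_le_div_iff₀ (hd₀.trans_le hstiff) hd₀]
  calc _ ≤ k₀ * d₀ := mul_le_mul_of_nonneg_right hick hd₀.le
    _ ≤ k₀ * _ := mul_le_mul_of_nonneg_left hstiff hk₀.le

/-! ### The diagonal slice on the summit's torus, and the summit from the target -/

/-- **The diagonal `M = L` of the target, in the summit's vocabulary.** If `TubeFamilyLaw` holds
then there are `U > 0`, `δ ∈ (0, 1/2)`, `C ≥ 0`, `A > 0`, `R, L₀` such that on every even square
torus `FermionTorus 2 L`, `L ≥ L₀`, every normalised `(2⌊(1-δ)L²/2⌋, S^z = 0)`-sector ground state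
`ψ` of `hubbardTorus 2 L 1 U` obeys the column law
`A L³ r̂^{-C/L} ≤ Σ_{a,b,b'} Re⟨ψ, P†_{(a,b)} P_{(a+r,b')} ψ⟩` (`P_x = localPair dWaveFormFactor L x`)
for `R ≤ r̂`: the labelling `e₀ x = (x₀, x₁)` of the torus has the tube adjacency of
`fermionTorusGraph 2 L` and the inlined column pair operator is `localPair dWaveFormFactor`
(part (2) of the route's `closes`). [cite: Scalapino1995, §2 eq. (2.4)] -/
theorem torusColumnLaw_of_tubeFamilyLaw : Summit.HubbardSuperconductivity.HubbardSuperconductivity.Theses.WidthHaldane.TubeFamilyLaw → ∃ U : ℝ, 0 < U ∧ ∃ δ ∈ Set.Ioo (0 : ℝ) (1 / 2), ∃ C : ℝ, 0 ≤ C ∧ ∃ A : ℝ, 0 < A ∧ ∃ R L₀ : ℕ, ∀ (L : ℕ) [NeZero L], Even L → L₀ ≤ L → ∀ ψ : Fock (Orb (FermionTorus 2 L)), star ψ ⬝ᵥ ψ = 1 → IsGroundStateInSector (hubbardTorus 2 L 1 U) (2 * ⌊(1 - δ) * (L : ℝ) ^ 2 / 2⌋₊) 0 ψ → ∀ r : ZMod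 L, R ≤ r.val → r.val + R ≤ L → A * (L : ℝ) ^ 3 * ((min r.val (L - r.val) : ℕ) : ℝ) ^ (-(C / (L : ℝ))) ≤ ∑ a : ZMod L, ∑ b : ZMod L, ∑ b' : ZMod L, (expect ((localPair dWaveFormFactor L ![a, b])ᴴ * localPair dWaveFormFactor L ![a + r, b']) ψ).re := by
  intro h
  rw [tubeFamilyLaw_iff] at h
  obtain ⟨U, hU, δ, hδ, C, hC, A, hA, R, M₁, L₀, hTL⟩ := h
  refine ⟨U, hU, δ, hδ, C, hC, A, hA, R, max L₀ M₁, fun L _ hev hK ψ hn1 hGS r hr1 hr2 => ?_⟩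
  obtain ⟨hL₀, hM₁⟩ := max_le_iff.1 hK
  -- the labelling `e₀ x = (x₀, x₁)` of the summit's torus
  obtain ⟨e₀, he₀, he₀s⟩ : ∃ e : FermionTorus 2 L ≃ ZMod L × ZMod L,
      (∀ x, e x = (FermionTorus.toTorusSite x 0, FermionTorus.toTorusSite x 1)) ∧
        ∀ p : ZMod L × ZMod L, e.symm p = FermionTorus.ofTorusSite ![p.1, p.2] :=
    ⟨FermionTorus.equivTorusSite.trans (finTwoArrowEquiv _), fun x => rfl, fun p => rfl⟩
  have hinj : ∀ u v : FermionTorus 2 L,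
      FermionTorus.toTorusSite u = FermionTorus.toTorusSite v ↔ u = v := fun u v =>
    (FermionTorus.equivTorusSite (d := 2) (L := L)).injective.eq_iff
  have hsymm : ∀ (v : FermionTorus 2 L) (p : ZMod L × ZMod L),
      v = e₀.symm p ↔ FermionTorus.toTorusSite v = ![p.1, p.2] := by
    intro v p
    rw [Equiv.eq_symm_apply, he₀, Prod.ext_iff, funext_iff, Fin.forall_fin_two]
    simp
  have hS0 : ∀ t : Fin 2 → ZMod L, t + Pi.single 0 1 = ![t 0 + 1, t 1] := fun t => by
    funext i; fin_cases i <;> simp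
  have hS1 : ∀ t : Fin 2 → ZMod L, t + Pi.single 1 1 = ![t 0, t 1 + 1] := fun t => by
    funext i; fin_cases i <;> simp
  have hp1 : ∀ t : Fin 2 → ZMod L,
      t + Literature.Probability.LatticeModels.Torus.proj L (Pi.single 0 1) = ![t 0 + 1, t 1] :=
    fun t => by funext i; fin_cases i <;> simp
  have hp2 : ∀ t : Fin 2 → ZMod L,
      t + Literature.Probability.LatticeModels.Torus.proj L (-Pi.single 0 1) = ![t 0 - 1, t 1] :=
    fun t => by funext i; fin_cases i <;> simp [sub_eq_add_neg]
  have hp3 : ∀ t : Fin 2 → ZMod L,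
      t + Literature.Probability.LatticeModels.Torus.proj L (Pi.single 1 1) = ![t 0, t 1 + 1] :=
    fun t => by funext i; fin_cases i <;> simp
  have hp4 : ∀ t : Fin 2 → ZMod L,
      t + Literature.Probability.LatticeModels.Torus.proj L (-Pi.single 1 1) = ![t 0, t 1 - 1] :=
    fun t => by funext i; fin_cases i <;> simp [sub_eq_add_neg]
  have hHc : ∀ (G₁ G₂ : SimpleGraph (FermionTorus 2 L)) (i₁ : DecidableRel G₁.Adj)
      (i₂ : DecidableRel G₂.Adj), (∀ x y, G₁.Adj x y ↔ G₂.Adj x y) →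
      @hamiltonian _ _ _ G₁ i₁ 1 U = @hamiltonian _ _ _ G₂ i₂ 1 U := by
    intro G₁ G₂ i₁ i₂ h
    have hG : G₁ = G₂ := by ext x y; exact h x y
    subst hG
    congr
  have hd1 : dWaveFormFactor (Pi.single 0 1) = 1 := if_pos (Or.inl rfl)
  have hd2 : dWaveFormFactor (-Pi.single 0 1) = 1 := if_pos (Or.inr rfl)
  have hd3 : dWaveFormFactor (Pi.single 1 1) = -1 := by
    have hne1 : (Pi.single 1 1 : Fin 2 → ℤ) ≠ Pi.single 0 1 := fun h => by simpa using congrFun h 0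
    have hne2 : (Pi.single 1 1 : Fin 2 → ℤ) ≠ -Pi.single 0 1 := fun h => by simpa using congrFun h 0
    rw [dWaveFormFactor, if_neg (not_or.2 ⟨hne1, hne2⟩), if_pos (Or.inl rfl)]
  have hd4 : dWaveFormFactor (-Pi.single 1 1) = -1 := by
    have hne3 : (-Pi.single 1 1 : Fin 2 → ℤ) ≠ Pi.single 0 1 := fun h => by simpa using congrFun h 0
    have hne4 : (-Pi.single 1 1 : Fin 2 → ℤ) ≠ -Pi.single 0 1 := fun h => by simpa using congrFun h 1
    rw [dWaveFormFactor, if_neg (not_or.2 ⟨hne3, hne4⟩), if_pos (Or.inr rfl)]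
  have hsum : ∀ {β : Type} [AddCommMonoid β] (f : (Fin 2 → ℤ) → β), ∑ e ∈ unitSteps, f e =
      f (Pi.single 0 1) + f (-Pi.single 0 1) + f (Pi.single 1 1) + f (-Pi.single 1 1) := by
    intro β _ f
    have h1 : (Pi.single 0 1 : Fin 2 → ℤ) ∉
        ({-Pi.single 0 1, Pi.single 1 1, -Pi.single 1 1} : Finset (Fin 2 → ℤ)) := by
      simp only [Finset.mem_insert, Finset.mem_singleton]; decide
    have h2 : (-Pi.single 0 1 : Fin 2 → ℤ) ∉ ({Pi.single 1 1, -Pi.single 1 1} : Finset (Fin 2 → ℤ)) := by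
      simp only [Finset.mem_insert, Finset.mem_singleton]; decide
    have h3 : (Pi.single 1 1 : Fin 2 → ℤ) ∉ ({-Pi.single 1 1} : Finset (Fin 2 → ℤ)) := by
      simp only [Finset.mem_singleton]; decide
    rw [unitSteps, Finset.sum_insert h1, Finset.sum_insert h2, Finset.sum_insert h3,
      Finset.sum_singleton]
    abel
  have key := hTL L L hev hev hM₁ le_rfl hL₀ (FermionTorus 2 L) e₀ ψ hn1
  convert key ?gs r hr1 hr2 using 1
  case gs =>
    convert hGS using 2
    · rw [hubbardTorus, tubeH0]
      refine hHc _ _ _ _ fun x y => ?_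
      simp only [SimpleGraph.fromRel_adj, fermionTorusGraph_adj,
        Literature.Probability.LatticeModels.torusGraph_adj_iff, Fin.exists_fin_two, hsymm, he₀, hS0,
        hS1, ne_eq, hinj]
    · simp only [tubeFilling, sq]
  · ring
  · unfold tubeColumnPairCorr tubeDWavePair
    simp only [Fin.sum_univ_four, Matrix.cons_val_zero, Matrix.cons_val_one, Matrix.cons_val,
      Equiv.apply_symm_apply]
    simp only [he₀s]
    refine Finset.sum_congr rfl fun a _ => ?_
    rw [Matrix.conjTranspose_sum, Finset.sum_mul]
    simp only [Finset.mul_sum, expect_sum, Complex.re_sum]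
    refine Finset.sum_congr rfl fun b _ => Finset.sum_congr rfl fun b' _ => ?_
    simp only [localPair_dWave_eq_localPairOn_unitSteps, localPairOn_eq_sum_singletBond, hsum,
      singletBond, hd1, hd2, hd3, hd4, hp1, hp2, hp3, hp4, Matrix.cons_val_zero, Matrix.cons_val_one]

/-- **TARGET ⇒ SUMMIT**: `TubeFamilyLaw → HubbardSuperconductivity`, without the cruxes (parts
(2)–(3) of the route's `closes` re-cut at the target). From the diagonal column law
(`torusColumnLaw_of_tubeFamilyLaw`) every sequence of normalised sector ground states of the pure
Hubbard tori has `Σ_{x,y} Re⟨ψ_L, P†_x P_y ψ_L⟩ ≥ (A/8) L⁴` at all large even `L`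
(`sum_pairCorr_ge_of_columnLaw`), hence `d_{x²-y²}` pair-field long-range order along the even
sides (`hasLongRangeOrder_even_of_le`) — literally the summit statement. So ANY proof of S⁺ closes
the summit. [cite: Scalapino1995, §2 eq. (2.4)] -/
theorem hubbardSuperconductivity_of_tubeFamilyLaw : Summit.HubbardSuperconductivity.HubbardSuperconductivity.Theses.WidthHaldane.TubeFamilyLaw → HubbardSuperconductivity := by
  intro h
  obtain ⟨U, hU, δ, hδ, C, hC, A, hA, R, L₀, hTL⟩ := torusColumnLaw_of_tubeFamilyLaw h
  refine ⟨U, hU, δ, hδ, fun N ψ hE => ?_⟩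
  obtain ⟨B, hB⟩ : ∃ B : ℝ, B = (∑ e ∈ insert (0 : Fin 2 → ℤ) unitSteps,
      ‖((dWaveFormFactor e / Real.sqrt 2 : ℝ) : ℂ)‖ * 2) ^ 2 := ⟨_, rfl⟩
  obtain ⟨L₂, hL₂⟩ := exists_half_le_rpow_neg_div C
  refine hasLongRangeOrder_even_of_le dWaveFormFactor ψ (fun n hn => (hE (n + 1) hn).2.1)
    (by positivity : (0 : ℝ) < A / 8)
    (max (max L₀ L₂) ⌈8 * ((max R 1 : ℕ) : ℝ) * (A + 2 * B) / A⌉₊) ?_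
  intro n hev hK
  obtain ⟨hN, hn1, hGS⟩ := hE (n + 1) hev
  rw [hN] at hGS
  simp only [max_le_iff] at hK
  obtain ⟨⟨hL₀, hL₂n⟩, hK⟩ := hK
  have hbig : 8 * ((max R 1 : ℕ) : ℝ) * (A + 2 * B) ≤ A * ((n + 1 : ℕ) : ℝ) := by
    have h1 := (Nat.le_ceil _).trans
      (show (⌈8 * ((max R 1 : ℕ) : ℝ) * (A + 2 * B) / A⌉₊ : ℝ) ≤ ((n + 1 : ℕ) : ℝ) by
        exact_mod_cast hK)
    rw [div_le_iff₀ hA] at h1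
    linarith
  subst hB
  simp only [pairFieldCorr_succ]
  refine sum_pairCorr_ge_of_columnLaw (ψ (n + 1)) hn1 hA hC (le_max_right R 1)
    (fun r hr1 hr2 => ?_) (hL₂ (n + 1) hL₂n) hbig
  exact hTL (n + 1) hev hL₀ (ψ (n + 1)) hn1 hGS r ((le_max_left R 1).trans hr1)
    (le_trans (Nat.add_le_add_left (le_max_left R 1) _) hr2)

/-- **The target is sandwiched**: cruxes ⇒ target ⇒ summit, i.e. the route's `closes` factors
through `TubeFamilyLaw` (bookkeeping corollary of the two theorems above). [folklore] -/
theorem hubbardSuperconductivity_of_cruxes_via_target (h1 : WidthHaldaneBridge)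
    (h2 : WidthUniformThermodynamics) : HubbardSuperconductivity :=
  hubbardSuperconductivity_of_tubeFamilyLaw (tubeFamilyLaw_of_widthHaldaneBridge h1 h2)

end Summit.HubbardSuperconductivity.HubbardSuperconductivity.Theorems.WidthHaldane

end
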